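import Mathlib
import Summits.QuantumFields.YangMills.Theorems.RationalShortRootRigidityQuarticF4Radial
import Summits.QuantumFields.YangMills.Theorems.RationalShortRootRigidityMobiusTopForm
import Summits.QuantumFields.YangMills.Theorems.RationalShortRootRigidityAlternationShell

/-!
# `RationalShortRootRigidity` — Step 4 (`stub_alternation`) assembly, part III: radiality from the quartic bottleneck

Part of the ASSEMBLY of Step 4 of the paper proof of crux `stmt-QuantumFields-23124`
(`F4SubCurvatureDoor.RationalShortRootRigidity`, LINE g15-A of planner ym-idea-3; birth skeleton
HOME l15/RationalShortRootRigidity-birth.lean, stub `stub_alternation`; plan HOME l15/STUB-PLAN-Alternation.md §3).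

**Theorem** (`radial_of_qComponents_le_four`).  Let `N(p) = E(p², q)` (shell picture, part II) where every monomial of `E`
has `q`-degree `≤ 4` (i.e. the `q`-homogeneous components of `q`-degree `≥ 5` vanish — the output of the alternation core,
part I), and let `N` be `W(B₄)`-invariant and invariant under the half-reflection `p ↦ p − ½(Σpᵢ)(1,1,1,1)`.  Then `N` is
radial: `N(p) = F(p²)`.

Proof (plan §3).  The homogeneous components `N^{(d)}` inherit both invariances (`eval_homogeneousComponent_eq_of_invariant`:
compare the polynomial identities `N(t·gp) = Σ t^d N^{(d)}(gp)` and `N(t·p)`).  In the shell picture `N^{(d)} = Ψ(E^{[d]})` with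
`E^{[d]}` the `(2,1,1,1)`-weight-`d` part of `E`; its monomials `X^a q^m` have `|m| ≤ 4`, so `X^{ν} ∣ E^{[d]}`, `ν = (d−4)/2`, and
`N^{(d)} = (p²)^ν · Z_d` with `Z_d` homogeneous of degree `d − 2ν` and (cancelling the invariant factor pointwise) invariant.
For even `d ≥ 4`, `Z_d` is an invariant quartic, hence `c·(p²)²` by the tree lemma `quarticF4Radial` (p-landed, (m15)); `d = 2`
likewise; `d = 0` is a constant; odd `d` vanish by `p ↦ −p`.  Summing, `N(p) = Σ_d c_d (p²)^{d/2}`.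

Mathlib + tree lemmas (`quarticF4Radial`, `eval_smul_of_isHomogeneous`, part II); THEOREMS ONLY; no named facts; no `sorry`;
default heartbeats.  Nothing about the crux 23124, the route's rung or the Yang–Mills mass gap is proved here.  Free-hands width
seat `ym-line-sfw-p2-w4` g18, `--supports stmt-QuantumFields-23124`.
-/

set_option autoImplicit false

namespace Summit.QuantumFields.YangMills.Theorems.RationalShortRootRigidity.Alternation

open scoped BigOperators Polynomial

/-! ### 1. Homogeneous components inherit invariance under degree-one-homogeneous maps -/

/-- If `N` is invariant (as a function) under a map `g` of `ℝ⁴` commuting with scalings, then so is every homogeneous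
component of `N`. [folklore] -/
theorem eval_homogeneousComponent_eq_of_invariant (N : MvPolynomial (Fin 4) ℝ) (g : (Fin 4 → ℝ) → (Fin 4 → ℝ))
    (hg : ∀ (t : ℝ) (p : Fin 4 → ℝ), g (t • p) = t • g p)
    (hinv : ∀ p : Fin 4 → ℝ, MvPolynomial.eval (g p) N = MvPolynomial.eval p N) (d : ℕ) (p : Fin 4 → ℝ) :
    MvPolynomial.eval (g p) (MvPolynomial.homogeneousComponent d N) =
      MvPolynomial.eval p (MvPolynomial.homogeneousComponent d N) := by
  classical
  set T := N.totalDegree with hT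
  -- the scaling identities
  have hexp : ∀ (t : ℝ) (v : Fin 4 → ℝ), MvPolynomial.eval (t • v) N =
      ∑ e ∈ Finset.range (T + 1), t ^ e * MvPolynomial.eval v (MvPolynomial.homogeneousComponent e N) := by
    intro t v
    conv_lhs => rw [← MvPolynomial.sum_homogeneousComponent (φ := N)]
    rw [map_sum]
    refine Finset.sum_congr rfl fun e _ => ?_
    exact eval_smul_of_isHomogeneous _ (MvPolynomial.homogeneousComponent_isHomogeneous e N) t v
  -- the polynomial in `t` whose coefficients are the differences
  set a : ℕ → ℝ := fun e => MvPolynomial.eval (g p) (MvPolynomial.homogeneousComponent e N) -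
    MvPolynomial.eval p (MvPolynomial.homogeneousComponent e N) with ha
  set P : ℝ[X] := ∑ e ∈ Finset.range (T + 1), Polynomial.monomial e (a e) with hP
  have hP0 : P = 0 := by
    apply Polynomial.funext
    intro t
    rw [Polynomial.eval_zero, hP, Polynomial.eval_finsetSum]
    simp only [Polynomial.eval_monomial, ha]
    have h1 := hexp t (g p)
    have h2 := hexp t p
    rw [← hg, hinv] at h1
    rw [h1] at h2
    have : ∑ e ∈ Finset.range (T + 1), (MvPolynomial.eval (g p) (MvPolynomial.homogeneousComponent e N) -
        MvPolynomial.eval p (MvPolynomial.homogeneousComponent e N)) * t ^ e =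
        ∑ e ∈ Finset.range (T + 1), t ^ e * MvPolynomial.eval (g p) (MvPolynomial.homogeneousComponent e N) -
        ∑ e ∈ Finset.range (T + 1), t ^ e * MvPolynomial.eval p (MvPolynomial.homogeneousComponent e N) := by
      rw [← Finset.sum_sub_distrib]
      refine Finset.sum_congr rfl fun e _ => ?_
      ring
    rw [this, h2, sub_self]
  by_cases hd : d ≤ T
  · have hc := congrArg (fun Q : ℝ[X] => Q.coeff d) hP0
    simp only [hP, Polynomial.finsetSum_coeff, Polynomial.coeff_monomial, Polynomial.coeff_zero,
      Finset.sum_ite_eq', Finset.mem_range] at hc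
    rw [if_pos (by omega)] at hc
    rw [ha] at hc
    exact sub_eq_zero.1 hc
  · rw [MvPolynomial.homogeneousComponent_eq_zero _ _ (by omega), map_zero, map_zero]

/-! ### 2. Dividing the weight-`d` part by `X^ν` -/

/-- If every monomial of `F` has `X`-exponent `≥ ν`, then `F = X^ν · Z` with `coeff_{m'} Z = coeff_{m' + ν e_X} F`. [folklore] -/
theorem exists_X_pow_mul (F : MvPolynomial (Fin 4) ℝ) (ν : ℕ) (h : ∀ m ∈ F.support, ν ≤ m 0) :
    ∃ Z : MvPolynomial (Fin 4) ℝ, F = MvPolynomial.X 0 ^ ν * Z ∧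
      ∀ m' : Fin 4 →₀ ℕ, MvPolynomial.coeff m' Z = MvPolynomial.coeff (m' + Finsupp.single 0 ν) F := by
  classical
  refine ⟨∑ m ∈ F.support, MvPolynomial.monomial (m - Finsupp.single 0 ν) (MvPolynomial.coeff m F), ?_, ?_⟩
  · rw [Finset.mul_sum]
    conv_lhs => rw [F.as_sum]
    refine Finset.sum_congr rfl fun m hm => ?_
    rw [← MvPolynomial.monomial_single_add, add_tsub_cancel_of_le]
    exact Finsupp.single_le_iff.2 (h m hm)
  · intro m'
    rw [MvPolynomial.coeff_sum]
    simp only [MvPolynomial.coeff_monomial]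
    have hcong : ∀ m ∈ F.support, (if m - Finsupp.single 0 ν = m' then MvPolynomial.coeff m F else 0) =
        (if m = m' + Finsupp.single 0 ν then MvPolynomial.coeff m F else 0) := by
      intro m hm
      have hle : Finsupp.single 0 ν ≤ m := Finsupp.single_le_iff.2 (h m hm)
      simp only [tsub_eq_iff_eq_add_of_le hle]
    rw [Finset.sum_congr rfl hcong, Finset.sum_ite_eq']
    split_ifs with hmem
    · rfl
    · exact (MvPolynomial.notMem_support_iff.1 hmem).symm

/-! ### 3. The radiality theorem -/

/-- `Σᵢ (gp)ᵢ² = Σᵢ pᵢ²` for signed permutations. [folklore] -/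
theorem sumSq_signedPerm (σ : Equiv.Perm (Fin 4)) (ε : Fin 4 → ℝ) (hε : ∀ i, ε i = 1 ∨ ε i = -1)
    (p : Fin 4 → ℝ) : ∑ i : Fin 4, (ε i * p (σ i)) ^ 2 = ∑ i : Fin 4, p i ^ 2 := by
  have h1 : ∀ i, (ε i * p (σ i)) ^ 2 = p (σ i) ^ 2 := by
    intro i
    rcases hε i with h | h <;> rw [h] <;> ring
  simp_rw [h1]
  exact Equiv.sum_comp σ (fun i => p i ^ 2)

/-- `Σᵢ (s p)ᵢ² = Σᵢ pᵢ²` for the half-reflection `s(p) = p − ½(Σpⱼ)(1,1,1,1)`. [folklore] -/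
theorem sumSq_half (p : Fin 4 → ℝ) :
    ∑ i : Fin 4, (p i - (∑ j : Fin 4, p j) / 2) ^ 2 = ∑ i : Fin 4, p i ^ 2 := by
  simp only [Fin.sum_univ_four]
  ring

/-- A sum of four real squares vanishes only at the origin. [folklore] -/
theorem eq_zero_of_sumSq_eq_zero (p : Fin 4 → ℝ) (h : ∑ i : Fin 4, p i ^ 2 = 0) : p = 0 := by
  funext i
  have := (Finset.sum_eq_zero_iff_of_nonneg (fun j _ => sq_nonneg (p j))).1 h i (Finset.mem_univ i)
  exact eq_zero_of_pow_eq_zero (n := 2) this |> fun h' => by simpa using h'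

/-- **Radiality from the quartic bottleneck** (Step 4 of the paper proof of 23124, plan §3).  In the shell picture
`N = Ψ(E)` with all `q`-homogeneous components of `E` of `q`-degree `≥ 5` vanishing, a `W(B₄)`- and half-reflection-invariant
`N` is radial. [folklore] -/
theorem radial_of_qComponents_le_four (E N : MvPolynomial (Fin 4) ℝ)
    (hE5 : ∀ b : ℕ, 5 ≤ b →
      MvPolynomial.weightedHomogeneousComponent (fun i : Fin 4 => if i = 0 then (0 : ℕ) else 1) b E = 0)
    (hN : N = MvPolynomial.bind₁
      (fun i : Fin 4 => if i = 0 then ∑ j : Fin 4, (MvPolynomial.X j : MvPolynomial (Fin 4) ℝ) ^ 2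
        else MvPolynomial.X i) E)
    (hB4 : ∀ (σ : Equiv.Perm (Fin 4)) (ε : Fin 4 → ℝ), (∀ i, ε i = 1 ∨ ε i = -1) →
      ∀ p : Fin 4 → ℝ, MvPolynomial.eval (fun i => ε i * p (σ i)) N = MvPolynomial.eval p N)
    (hHalf : ∀ p : Fin 4 → ℝ, MvPolynomial.eval (fun i => p i - (∑ j, p j) / 2) N = MvPolynomial.eval p N) :
    ∃ F : Polynomial ℝ, ∀ p : Fin 4 → ℝ, MvPolynomial.eval p N = F.eval (∑ i, p i ^ 2) := by
  classical
  -- (b) every monomial of `E` has `q`-degree ≤ 4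
  have hq4 : ∀ m ∈ E.support, ∑ i : Fin 3, m (Fin.succ i) ≤ 4 := by
    intro m hm
    by_contra hlt
    push Not at hlt
    have h0 := hE5 _ hlt
    have hc := congrArg (MvPolynomial.coeff m) h0
    rw [MvPolynomial.coeff_weightedHomogeneousComponent, weight_q, if_pos rfl, MvPolynomial.coeff_zero] at hc
    exact (MvPolynomial.mem_support_iff.1 hm) hc
  -- invariance of the homogeneous components
  have hB4d : ∀ (d : ℕ) (σ : Equiv.Perm (Fin 4)) (ε : Fin 4 → ℝ), (∀ i, ε i = 1 ∨ ε i = -1) →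
      ∀ p : Fin 4 → ℝ, MvPolynomial.eval (fun i => ε i * p (σ i)) (MvPolynomial.homogeneousComponent d N) =
        MvPolynomial.eval p (MvPolynomial.homogeneousComponent d N) := by
    intro d σ ε hε p
    refine eval_homogeneousComponent_eq_of_invariant N (fun v => fun i => ε i * v (σ i)) ?_ (hB4 σ ε hε) d p
    intro t v
    funext i
    simp only [Pi.smul_apply, smul_eq_mul]
    ring
  have hHalfd : ∀ (d : ℕ) (p : Fin 4 → ℝ),
      MvPolynomial.eval (fun i => p i - (∑ j, p j) / 2) (MvPolynomial.homogeneousComponent d N) =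
        MvPolynomial.eval p (MvPolynomial.homogeneousComponent d N) := by
    intro d p
    refine eval_homogeneousComponent_eq_of_invariant N (fun v => fun i => v i - (∑ j, v j) / 2) ?_ hHalf d p
    intro t v
    funext i
    simp only [Pi.smul_apply, smul_eq_mul, ← Finset.mul_sum]
    ring
  -- (e) the value of each homogeneous component
  have hcomp : ∀ d : ℕ, ∃ c : ℝ, ∀ p : Fin 4 → ℝ,
      MvPolynomial.eval p (MvPolynomial.homogeneousComponent d N) = c * (∑ i, p i ^ 2) ^ (d / 2) := by
    intro d
    rcases Nat.even_or_odd d with hev | hodd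
    · -- even `d`: structure `N^{(d)} = (p²)^ν · Z_d`
      set ν : ℕ := (d - 4) / 2 with hν
      set Ed := MvPolynomial.weightedHomogeneousComponent (fun i : Fin 4 => if i = 0 then (2 : ℕ) else 1) d E
        with hEd
      have hNd : MvPolynomial.homogeneousComponent d N = MvPolynomial.bind₁
          (fun i : Fin 4 => if i = 0 then ∑ j : Fin 4, (MvPolynomial.X j : MvPolynomial (Fin 4) ℝ) ^ 2
            else MvPolynomial.X i) Ed := by
        rw [hN, homogeneousComponent_shell]
      have hEdsupp : ∀ m ∈ Ed.support, 2 * m 0 + ∑ i : Fin 3, m (Fin.succ i) = d ∧ m ∈ E.support := by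
        intro m hm
        rw [hEd, MvPolynomial.support_weightedHomogeneousComponent, Finset.mem_filter, weight_two] at hm
        exact ⟨hm.2, hm.1⟩
      have hνle : ∀ m ∈ Ed.support, ν ≤ m 0 := by
        intro m hm
        obtain ⟨hw, hmE⟩ := hEdsupp m hm
        have := hq4 m hmE
        omega
      obtain ⟨Zt, hEdZ, hZcoeff⟩ := exists_X_pow_mul Ed ν hνle
      -- `Zt` has weight `d − 2ν`
      have hZt : MvPolynomial.IsWeightedHomogeneous (fun i : Fin 4 => if i = 0 then (2 : ℕ) else 1) Zt (d - 2 * ν) := by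
        intro m' hm'
        rw [hZcoeff] at hm'
        have hmem : m' + Finsupp.single 0 ν ∈ Ed.support := MvPolynomial.mem_support_iff.2 hm'
        obtain ⟨hw, -⟩ := hEdsupp _ hmem
        rw [weight_two]
        simp only [Finsupp.add_apply, Finsupp.single_eq_same, Finsupp.single_eq_of_ne (Fin.succ_ne_zero _),
          add_zero] at hw
        omega
      set Z := MvPolynomial.bind₁
        (fun i : Fin 4 => if i = 0 then ∑ j : Fin 4, (MvPolynomial.X j : MvPolynomial (Fin 4) ℝ) ^ 2
          else MvPolynomial.X i) Zt with hZ
      have hZhom : Z.IsHomogeneous (d - 2 * ν) := isHomogeneous_shell_of_isWeightedHomogeneous Zt _ hZt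
      have hNdZ : MvPolynomial.homogeneousComponent d N =
          (∑ j : Fin 4, (MvPolynomial.X j : MvPolynomial (Fin 4) ℝ) ^ 2) ^ ν * Z := by
        rw [hNd, hEdZ, map_mul, map_pow, MvPolynomial.bind₁_X_right, hZ]
        simp only [↓reduceIte]
      have hevalNd : ∀ p : Fin 4 → ℝ, MvPolynomial.eval p (MvPolynomial.homogeneousComponent d N) =
          (∑ i, p i ^ 2) ^ ν * MvPolynomial.eval p Z := by
        intro p
        rw [hNdZ, map_mul, map_pow, map_sum]
        simp only [map_pow, MvPolynomial.eval_X]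
      -- invariance of `Z` (cancel the invariant factor pointwise)
      have hcancel : ∀ (g : (Fin 4 → ℝ) → (Fin 4 → ℝ)), (∀ p, ∑ i, (g p) i ^ 2 = ∑ i, p i ^ 2) → g 0 = 0 →
          (∀ p, MvPolynomial.eval (g p) (MvPolynomial.homogeneousComponent d N) =
            MvPolynomial.eval p (MvPolynomial.homogeneousComponent d N)) →
          ∀ p, MvPolynomial.eval (g p) Z = MvPolynomial.eval p Z := by
        intro g hgsq hg0 hginv p
        by_cases hp : ∑ i, p i ^ 2 = 0
        · have hp0 : p = 0 := eq_zero_of_sumSq_eq_zero p hp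
          rw [hp0, hg0]
        · have h := hginv p
          rw [hevalNd, hevalNd, hgsq] at h
          exact mul_left_cancel₀ (pow_ne_zero ν hp) h
      have hB4Z : ∀ (σ : Equiv.Perm (Fin 4)) (ε : Fin 4 → ℝ), (∀ i, ε i = 1 ∨ ε i = -1) →
          ∀ p : Fin 4 → ℝ, MvPolynomial.eval (fun i => ε i * p (σ i)) Z = MvPolynomial.eval p Z := by
        intro σ ε hε
        refine hcancel (fun v => fun i => ε i * v (σ i)) (sumSq_signedPerm σ ε hε) ?_ (hB4d d σ ε hε)
        funext i
        simp
      have hHalfZ : ∀ p : Fin 4 → ℝ, MvPolynomial.eval (fun i => p i - (∑ j, p j) / 2) Z = MvPolynomial.eval p Z := by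
        refine hcancel (fun v => fun i => v i - (∑ j, v j) / 2) sumSq_half ?_ (hHalfd d)
        funext i
        simp
      -- case analysis on the even degree
      obtain ⟨e, he⟩ := hev
      by_cases hd4 : 4 ≤ d
      · -- quartic bottleneck
        have h4 : d - 2 * ν = 4 := by omega
        rw [h4] at hZhom
        obtain ⟨c, hc⟩ := quarticF4Radial.1 Z hZhom hB4Z hHalfZ
        refine ⟨c, fun p => ?_⟩
        rw [hevalNd, hc, map_mul, MvPolynomial.eval_C, map_pow, map_sum]
        simp only [map_pow, MvPolynomial.eval_X]
        have hexp : d / 2 = ν + 2 := by omega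
        rw [hexp, pow_add]
        ring
      · by_cases hd2 : d = 2
        · subst hd2
          have h2 : 2 - 2 * ν = 2 := by omega
          rw [h2] at hZhom
          obtain ⟨c, hc⟩ := quarticF4Radial.2 Z hZhom hB4Z
          refine ⟨c, fun p => ?_⟩
          rw [hevalNd, hc, map_mul, MvPolynomial.eval_C, map_sum]
          simp only [map_pow, MvPolynomial.eval_X]
          have hν0 : ν = 0 := by omega
          rw [hν0]
          norm_num
        · have hd0 : d = 0 := by omega
          subst hd0
          refine ⟨MvPolynomial.coeff 0 N, fun p => ?_⟩
          rw [MvPolynomial.homogeneousComponent_zero, MvPolynomial.eval_C]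
          simp
    · -- odd `d`: the component vanishes (`p ↦ −p`)
      refine ⟨0, fun p => ?_⟩
      rw [zero_mul]
      have h := hB4d d 1 (fun _ => (-1 : ℝ)) (fun _ => Or.inr rfl) p
      have hneg : (fun i : Fin 4 => (-1 : ℝ) * p ((1 : Equiv.Perm (Fin 4)) i)) = (-1 : ℝ) • p := by
        funext i
        simp
      rw [hneg, eval_smul_of_isHomogeneous _ (MvPolynomial.homogeneousComponent_isHomogeneous d N),
        hodd.neg_one_pow] at h
      linarith
  -- (f) assemble the radial profile
  choose c hc using hcomp
  refine ⟨∑ d ∈ Finset.range (N.totalDegree + 1), Polynomial.C (c d) * Polynomial.X ^ (d / 2), fun p => ?_⟩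
  conv_lhs => rw [← MvPolynomial.sum_homogeneousComponent (φ := N)]
  rw [map_sum, Polynomial.eval_finsetSum]
  refine Finset.sum_congr rfl fun d _ => ?_
  rw [hc d p, Polynomial.eval_mul, Polynomial.eval_C, Polynomial.eval_pow, Polynomial.eval_X]

end Summit.QuantumFields.YangMills.Theorems.RationalShortRootRigidity.Alternation
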